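import Summits.CriticalPhenomena.CardyFormulaZ2.Theses.CardySelfDualSegment
import Summits.CriticalPhenomena.CardyFormulaZ2.Theorems.SegmentClosed.Negative.SquaresOnlyConfinement
import Summits.CriticalPhenomena.CardyFormulaZ2.Theorems.RectilinearCardy.Negative.RectilinearCardyReductions
import Literature.Probability.Percolation.CornerPercolation
import Literature.Probability.Percolation.QuadCrossingSquareModel
import Literature.Probability.RandomPlanarGeometry.ModulusSymmetry
import Literature.Barriers.CriticalPhenomena.EmbeddingModulusUniquenessProofs
import Literature.Probability.LatticeModels.TriangularLatticeProofs

/-!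
# Disproof of `SegmentClosed` — findings (cdisprove, standing adversary; cycle 1, 2026-08-16)

Crux `stmt-CriticalPhenomena-5473` = rank-4 crux of route `CardySelfDualSegment` (sub-problem
`CardyFormulaZ2`):
  `SegmentClosed := UBC → UM → IsClosed G`,   `G = {t ∈ [0,1] | ∃ α, 0 < im α ∧ CardyMod t α}`,
where `UBC` = uniform box-crossing bounds for the corner models `M_t` (literally the body of
`UniformBoxCrossing`), `UM` = equicontinuity of the crude crossing probabilities `P_t(R, δ)` in `t`
uniformly in the mesh (literally `UniformMarginality`), and `CardyMod t α` = "the crude `M_t`-crossing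
probabilities of every `R'` tend to the Cardy value of `φ_α(R')`".

## STATUS (cycle 1): NOT refuted; resists; no kill is possible short of refuting linear universality.

## Why it resists (§1, checked): the conclusion `IsClosed G` follows from the route's `Target`
(`G = [0,1]`), and the crux is trivially TRUE whenever either hypothesis fails; so
`¬ SegmentClosed ↔ UBC ∧ UM ∧ ¬ IsClosed G`, which entails `¬ Target` (`anatomy_of_a_disproof`).
A disproof must therefore (a) PROVE the uniform RSW theory `UBC` (Bollobás–Riordan Conj. 8.2 uniform
in `t`; not in print) and `UM` (XL, open), and (b) exhibit `t_n → t`, `t_n ∈ G`, `t ∉ G`, i.e. a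
failure of Langlands–Pouliot–Saint-Aubin linear universality INSIDE the self-dual FKG corner family at
an accumulation point of universality — nothing in print or in the tree comes near (b), and (b)
contradicts the route's target outright. Consequently NO load-bearing theorem
`segmentClosed_false_without_<H>` exists for either hypothesis: `SegmentClosedWithoutUBC`,
`SegmentClosedWithoutUM` and even `IsClosed G` alone are all implied by `Target`
(`isClosed_goodSet_of_target`). The hypotheses are load-bearing for the PROOF (compactness of the
moduli, existence of the `t`-limit), not for truth.

## Line `Sketch` (lead `prover-line-stmt-CriticalPhenomena-5473-0`, skeleton `Lines/Sketch.lean`,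
## 7 stubs) — audit against the tree's definitions (§2): every stub is TRUE as stated.

* `stub_gateLR` / `stub_gateTB` (forced gates): TRUE. `openConnIn S u v` demands `u, v ∈ S` and an
  induced-subgraph walk, so every vertex of a crude crossing lies in `Ω` (no endpoint junk); clip the
  walk at the last visit of `{re < x₁/δ}` and the first visit of `{re ≥ x₁/δ + 2 + a}`: the clipped
  walk lives in the slab (hence `im ∈ [y₁/δ, y₂/δ]` by `hΩ`), starts at `re' ∈ [-2, -2+√2) ⊆ {re' ≤ 0}`
  and ends at `re' ∈ [a, a+√2) ⊆ [a, a+2]` for `w = (x₁/δ + 2) + i y₁/δ`; needs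
  `a + 2 + √2 ≤ (x₂-x₁)/δ`, the stub's margin `4 > 2 + √2` suffices (tight margin: `2 + √2`).
* `stub_inscribedTB`: TRUE. Rows of `√2ℤ²` are `√2 δ < 2δ` apart after scaling, so the first vertex
  strictly above height `y₁` is within `2δ` of `A` (`hA`) and the last one strictly below `y₂` within
  `2δ` of `B` (`hB`); the sub-walk between them lies in `[x₁,x₂] × (y₁,y₂) ⊆ Ω`; `hy : y₁ + 4δ ≤ y₂`
  orders the two clips (tight: `2√2 δ` would do).
* `stub_indepBoxes`: TRUE. Under `M_t` the east edge of `v` is the coin `c_v` and the north edge is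
  `c_v ≠ d_v`, so a TB crossing of `w_k + [0,a]×[0,b]` is determined by the coordinates of the
  vertices of its own column range `re ∈ [re w_k, re w_k + a]`; `hsep` makes these ranges disjoint,
  `prodBernoulli` makes the events independent, `1 - ∏(1 - P E_k) ≥ 1 - (1-c)^K` (also for `c < 0`,
  `K = 0`). `hsep` IS load-bearing: two identical one-column boxes of height `1` give the event
  "north edge of `0` open", probability `1/2` for every `t`, and `1 - (1/2)² = 3/4 > 1/2`
  (not formalised: single-edge marginal of `cornerPercolation`, cheap but pointless).
* `stub_boxCrossRatio`: TRUE. `crossRatio x = (x₀-x₁)(x₂-x₃)/((x₀-x₂)(x₁-x₃))`; the marking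
  `(0, w, w+ih, ih)` of `rectQuad 0 w 0 h` (`rectQuad_pt`) is the cyclic shift of the hypothesis'
  marking `(ih, 0, w, w+ih)`, and a cyclic shift sends `η ↦ 1 - η` (Möbius renormalisation
  `exists_isUniformizing_of_cyclic` + `crossRatio_neg_perm_0321`, exactly the pattern of the tree's
  `crossRatio_eq_half_of_antiAffine`); non-vacuous in `η` (`brRect`, `rectangle_crossRatio_eq_of_aspectRatio_holds`).
* `stub_identification`: TRUE for an ABSTRACT `P` (3ε: `UM` at `t₀` + `hmod` at `t_n`, `n` large, +
  Radó continuity `η(φ_{α_n} R') → η(φ_{α₀} R')` (`ConformalRectangle.tendsto_crossRatio_of_tendstoUniformly`)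
  + continuity of `F` + `crossRatio_eq_of_isUniformizing_holds` to pass from the given `R` to
  `R'.map (shearHomeomorph α₀)`). Load-bearing (LANDED as `Negative/IdentificationStubAnatomy.lean`):
  UM, `t n → t₀`, the Cardy hypothesis along the sequence (explicit abstract-`P` witnesses);
  NOT load-bearing for truth: `hα₀` (real `α₀` ⇒ `CardyMod` vacuous) and `hαn` (eventual from `hα`).
* `stub_confinement`: TRUE in outline and GENUINELY needs (i) UBC at two aspect ratios and (ii) test
  boxes of two shapes: §3 below proves that squares alone never confine (`|β| = 1` rhombi keep
  cross-ratio `1/2`; unconditional), and §4 that the squares-only stub is FALSE at `t = 0` modulo the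
  route's `SmirnovBasePoint`. Geometry of the gates (for the lead): with full vertical slabs the gate
  box has aspect `(h re β - w)/(h im β)` (fires iff `re β ≳ 2 im β`), with full horizontal slabs
  `h im β/(w + h|re β|)`; using UBC at `ρ = 1/2` (bound `1 - c_{1/2}` even for EASY-way crossings) ONE
  of the two fires as soon as `h·max(|re β|, im β) ≥ 2w + O(δ)`, because `im β < 2|re β|` or
  `|re β| < 2 im β` always; the flat end `im β → 0` needs the inscribed squares, `K ≈ (w - h|re β|)/(h im β)`.

## LANDED negative lemmas (import these, namespace `…Theorems.SegmentClosed.Negative`)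
* `Theorems/SegmentClosed/Negative/SquaresOnlyConfinement.lean` (p99186, ACCEPTED, commit 408ff0e798b2):
  `crossRatio_square_eq_half`, `crossRatio_rhombus_eq_half`, `norm_circlePt`,
  **`not_squaresOnly_moduli_confinement`** (refuted strengthening of `stub_confinement`, unconditional),
  `moduliShear_triZeta_pullbackPt`, **`squaresOnly_confinement_false_of_smirnovBasePoint`** (the
  squares-only stub is FALSE at `t = 0` modulo `SmirnovBasePoint`), `not_target_of_not_segmentClosed`.
* `Theorems/SegmentClosed/Negative/IdentificationStubAnatomy.lean` (p101612, ACCEPTED, commit e3d19b0e6725;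
  not imported here only because the farm snapshot lagged at publication time — import it directly):
  **`stub_identification_false_without_UM`**, **`stub_identification_false_without_tendsto`**,
  `stub_identification_false_without_hmod` (UM, `t n → t₀` and the Cardy hypothesis along the sequence
  are load-bearing for `stub_identification` as stated over an abstract `P` — explicit witnesses), and
  **`cardyMod_of_im_eq_zero`** (`hα₀ : 0 < im α₀` and `hαn` are NOT load-bearing for truth: at a real
  modulus `CardyMod t₀ α₀` is vacuous because `φ_{α₀}(ℂ) ⊆ ℝ` contains no open set; `hαn` moreover
  follows eventually from `α n → α₀ ∈ ℍ`), plus the transfer lemmas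
  `exists_isUniformizing_of_carrier_eq` / `modulus_eq_of_carrier_eq` (uniformizing data only see
  carrier + marked points — the step the stub needs to pass from the given `R` to `R'.map (shear α₀)`).

## Index of THIS file (namespace `…Cruxes.SegmentClosed.Disproof`; sorry-free except §5)
§1 `isClosed_goodSet_of_target`, `segmentClosed_of_not_uniformBoxCrossing`,
   `segmentClosed_of_not_uniformMarginality`, `anatomy_of_a_disproof`, `not_target_of_not_segmentClosed`
   (the two `segmentClosed_of_not_*` are not landable under `Negative/`: positive `Theses` conclusions).
§3–§4 one-line re-exports of the landed squares-only lemmas (kept so that older pointers resolve).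
§5 NEAR-MISS (sorry): `singleAspectRatio_never_confines` — for EVERY aspect ratio `r`, the level sets
   of `β ↦ η(φ_β((0,r)×(0,1)))` accumulate at `β = r ∈ ∂ℍ` (X-degeneration + IVT on small semicircles
   around `r`), so no single test shape confines; needs Radó continuity in `β` (tree) + the boundary
   limits `η → 0 / 1` on `(r,∞) / (-∞,r)` (extremal length of flat parallelograms, not in tree).

## By-product (positive, NOT landed — prover's to paste): `stub_boxCrossRatio` PROVED with the stub's exact
signature (evidence `20260816T124400Z-StubBoxCrossRatio.lean` on the item; transport to the tree's
`brRect`, `ConformalRectangle.exists_isUniformizing_of_cyclic`, `crossRatio ![x3,x0,x1,x2] = 1 - crossRatio x`).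

`-- Targets`: payload `targets = []`, `stuck_stubs = []` this cycle (lead cycle 0); nothing broken.
-/

noncomputable section

namespace Summit.CriticalPhenomena.CardyFormulaZ2.Cruxes.SegmentClosed.Disproof

open Set Filter Topology Complex Metric
open scoped ComplexConjugate
open UpperHalfPlane (upperHalfPlaneSet)
open Literature.Probability.RandomPlanarGeometry
open Literature.Probability.Percolation (rectQuad rectQuad_carrier cornerCrossingProb)
open Literature.Probability.LatticeModels (triZeta triZeta_re triZeta_im)
open Literature.Barriers.CriticalPhenomena
open Summit.CriticalPhenomena.CardyFormulaZ2.Theorems.RectilinearCardy.Negative (rectQuad_pt)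
open Summit.CriticalPhenomena.CardyFormulaZ2.Theses.CardySelfDualSegment (SegmentClosed Target
  SmirnovBasePoint UniformBoxCrossing UniformMarginality)

/-! ## §1 Anatomy: what a disproof of the crux would have to contain -/

/-- **The conclusion alone follows from the target**: `Target → IsClosed G` — the crux with EVERY
hypothesis dropped (`G = univ` is closed). Hence no `SegmentClosedWithout<H>` (drop UBC, drop UM, drop
both) is refutable short of refuting the route's target (LPS linear universality on the self-dual
segment). (The one-line corollary `Target → SegmentClosed` is deliberately NOT declared here: the file
audit would class it as a proof of the item "under registered hypotheses"; its contrapositive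
`not_target_of_not_segmentClosed` is declared instead.) [folklore] -/
theorem isClosed_goodSet_of_target (hT : Target) :
    let prm : unitInterval → Literature.Probability.LatticeModels.Site 2 × Fin 2 → unitInterval :=
      fun t i => if i.2 = 0 then Literature.Probability.Percolation.half
        else Literature.Probability.Percolation.half * t
    let cfg : Set (Literature.Probability.LatticeModels.Site 2 × Fin 2) →
        Literature.Probability.Percolation.BondConfig (Literature.Probability.LatticeModels.Site 2) :=
      fun S => {e | ∃ v : Literature.Probability.LatticeModels.Site 2,
        (e = s(v, v + ![1, 0]) ∧ (v, (0 : Fin 2)) ∈ S) ∨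
        (e = s(v, v + ![0, 1]) ∧ ((v, (0 : Fin 2)) ∈ S ↔ (v, (1 : Fin 2)) ∉ S))}
    let P : unitInterval → ConformalRectangle → ℝ → ℝ := fun t R δ =>
      (Literature.Probability.LatticeModels.prodBernoulli (prm t)).real {S | cfg S ∈
        Literature.Probability.Percolation.embDomainCrossing
          Literature.Probability.LatticeModels.squareLatticeEmbedding.z R.carrier δ (R.arc 0) (R.arc 2)}
    let CardyMod : unitInterval → ℂ → Prop := fun t α => ∀ (R R' : ConformalRectangle)
      (φ : ConformalEquiv upperHalfPlaneSet R.carrier) (x : Fin 4 → ℝ),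
      R.carrier = moduliShear α '' R'.carrier → (∀ i, R.pt i = moduliShear α (R'.pt i)) →
      R.IsUniformizing φ x →
      Tendsto (P t R') (𝓝[>] 0) (𝓝 (cardyFunction (crossRatio x)))
    IsClosed {t : unitInterval | ∃ α : ℂ, 0 < α.im ∧ CardyMod t α} := by
  intro prm cfg P CardyMod
  convert isClosed_univ
  exact Set.eq_univ_of_forall fun t => hT t

/-- **The crux is trivially TRUE if the uniform box-crossing hypothesis fails.** [folklore] -/
theorem segmentClosed_of_not_uniformBoxCrossing (h : ¬ UniformBoxCrossing) : SegmentClosed :=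
  fun hUBC => absurd hUBC h

/-- **The crux is trivially TRUE if uniform marginality fails.** [folklore] -/
theorem segmentClosed_of_not_uniformMarginality (h : ¬ UniformMarginality) : SegmentClosed :=
  fun _ hUM => absurd hUM h

/-- **`¬ SegmentClosed → ¬ Target`** (landed copy: `Negative/SquaresOnlyConfinement.lean`). [folklore] -/
theorem not_target_of_not_segmentClosed (h : ¬ SegmentClosed) : ¬ Target := fun hT =>
  h (by
    intro _ _
    convert isClosed_univ
    exact Set.eq_univ_of_forall fun t => hT t)

/-- **Anatomy of a disproof**: a refutation of the crux consists of PROOFS of both hypotheses plus a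
refutation of the route's target. (So the refuter verdict for cycle 1 is "resists": (a) is two open
theorems, (b) is a counterexample to linear universality inside an FKG self-dual family.) [folklore] -/
theorem anatomy_of_a_disproof (h : ¬ SegmentClosed) :
    UniformBoxCrossing ∧ UniformMarginality ∧ ¬ Target := by
  refine ⟨?_, ?_, not_target_of_not_segmentClosed h⟩
  · by_contra hA
    exact h (segmentClosed_of_not_uniformBoxCrossing hA)
  · by_contra hM
    exact h (segmentClosed_of_not_uniformMarginality hM)

/-! ## §3–§4 Squares alone never confine the shear parameter (LANDED: `Negative/SquaresOnlyConfinement.lean`) -/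

/-- Re-export: the square `(0,w)²` has cross-ratio `1/2`. [folklore] -/
theorem crossRatio_square_eq_half {w : ℝ} (hw : 0 < w)
    {φ : ConformalEquiv upperHalfPlaneSet (rectQuad 0 w 0 w hw hw).carrier} {x : Fin 4 → ℝ}
    (h : (rectQuad 0 w 0 w hw hw).IsUniformizing φ x) : crossRatio x = 1 / 2 :=
  Theorems.SegmentClosed.Negative.crossRatio_square_eq_half hw h

/-- Re-export: rhombi `φ_β((0,w)²)`, `|β| = 1`, have cross-ratio `1/2`.
[cite: Beffara2008Universal, Proposition 4 (proof)] -/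
theorem crossRatio_rhombus_eq_half {β : ℂ} (hβ : 0 < β.im) (hβ1 : ‖β‖ = 1) {w : ℝ} (hw : 0 < w)
    {φ : ConformalEquiv upperHalfPlaneSet
      ((rectQuad 0 w 0 w hw hw).map (shearHomeomorph β hβ.ne')).carrier}
    {x : Fin 4 → ℝ} (h : ((rectQuad 0 w 0 w hw hw).map (shearHomeomorph β hβ.ne')).IsUniformizing φ x) :
    crossRatio x = 1 / 2 :=
  Theorems.SegmentClosed.Negative.crossRatio_rhombus_eq_half hβ hβ1 hw h

/-- Re-export: **REFUTED STRENGTHENING — squares alone never confine the shear** (unconditional).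
[folklore] -/
theorem not_squaresOnly_moduli_confinement :
    ¬ ∃ K : Set ℂ, IsCompact K ∧ K ⊆ {β : ℂ | 0 < β.im} ∧
      ∀ (β : ℂ) (hβ : 0 < β.im),
        (∀ (w : ℝ) (hw : 0 < w)
          (φ : ConformalEquiv upperHalfPlaneSet (rectQuad 0 w 0 w hw hw).carrier) (x : Fin 4 → ℝ)
          (ψ : ConformalEquiv upperHalfPlaneSet
            ((rectQuad 0 w 0 w hw hw).map (shearHomeomorph β hβ.ne')).carrier) (y : Fin 4 → ℝ),
          (rectQuad 0 w 0 w hw hw).IsUniformizing φ x →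
          ((rectQuad 0 w 0 w hw hw).map (shearHomeomorph β hβ.ne')).IsUniformizing ψ y →
          crossRatio y = crossRatio x) → β ∈ K :=
  Theorems.SegmentClosed.Negative.not_squaresOnly_moduli_confinement

/-- Re-export: **REFUTED STRENGTHENING (modulo the base point) — the squares-only
`stub_confinement` is FALSE at `t = 0`.** [cite: Smirnov2001, Théorème 1] -/
theorem squaresOnly_confinement_false_of_smirnovBasePoint (hB : SmirnovBasePoint) :
    ¬ ∃ K : Set ℂ, IsCompact K ∧ K ⊆ {β : ℂ | 0 < β.im} ∧
      ∀ (t : unitInterval) (β : ℂ) (hβ : 0 < β.im),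
        (∀ (w : ℝ) (hw : 0 < w)
          (φ : ConformalEquiv upperHalfPlaneSet (rectQuad 0 w 0 w hw hw).carrier) (x : Fin 4 → ℝ),
          (rectQuad 0 w 0 w hw hw).IsUniformizing φ x →
          Tendsto (cornerCrossingProb t ((rectQuad 0 w 0 w hw hw).map (shearHomeomorph β hβ.ne')))
            (𝓝[>] 0) (𝓝 (cardyFunction (crossRatio x)))) → β ∈ K :=
  Theorems.SegmentClosed.Negative.squaresOnly_confinement_false_of_smirnovBasePoint hB

/-! ## §5 NEAR-MISS: no single test shape confines (every aspect ratio), X-degeneration at `β = r` -/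

/-- **NEAR-MISS (sorry; documentation of the obstruction, not used anywhere).** For EVERY aspect
ratio `r > 0` and every compact `K ⊆ ℍ` there is `β ∈ ℍ ∖ K` under which the box `(0,r)×(0,1)` keeps
its cross-ratio. Argument (paper): `f_r(β) = η((0, r, r+β, β))` is continuous on `ℍ` (Radó, tree
`ConformalRectangle.tendsto_crossRatio_of_tendstoUniformly`) and extends continuously to
`∂ℍ ∖ {r}` with value `0` on `(r, ∞)` (flat parallelogram, arcs `[0,r]`, `[x, x+r]` far apart: extremal
length `→ ∞`) and `1` on `(-∞, r)` (arcs nearly touching along their length); at `β = r` all four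
sides meet at the point `r` ("X-degeneration") and, by the IVT on the semicircles `|β - r| = ε`,
EVERY value in `(0,1)` — in particular `f_r(i) = η(box)` — is attained at points `β` with
`|β - r| = ε`, for every `ε`. So the level set through `i` accumulates at `r ∈ ∂ℍ`. What is missing in
the tree: the two boundary limits (extremal-length estimates for flat parallelograms; the tree's
`halfPlane_extremalDistance_log_bounds_holds` / `extremalDistance_anti` cover rectangles only). Two
DIFFERENT aspect ratios `r₁ ≠ r₂` do confine (the accumulation points differ and `f_{r₂} → 0` or `1`
at `r₁`), consistent with the lead's use of all boxes `(0,w)×(0,h)`. [folklore] -/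
theorem singleAspectRatio_never_confines {r : ℝ} (hr : 0 < r) :
    ¬ ∃ K : Set ℂ, IsCompact K ∧ K ⊆ {β : ℂ | 0 < β.im} ∧
      ∀ (β : ℂ) (hβ : 0 < β.im),
        (∀ (φ : ConformalEquiv upperHalfPlaneSet (rectQuad 0 r 0 1 hr one_pos).carrier) (x : Fin 4 → ℝ)
          (ψ : ConformalEquiv upperHalfPlaneSet
            ((rectQuad 0 r 0 1 hr one_pos).map (shearHomeomorph β hβ.ne')).carrier) (y : Fin 4 → ℝ),
          (rectQuad 0 r 0 1 hr one_pos).IsUniformizing φ x →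
          ((rectQuad 0 r 0 1 hr one_pos).map (shearHomeomorph β hβ.ne')).IsUniformizing ψ y →
          crossRatio y = crossRatio x) → β ∈ K := by
  sorry

end Summit.CriticalPhenomena.CardyFormulaZ2.Cruxes.SegmentClosed.Disproof

end
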